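import Literature.Computability.FineGrained.DTWAlignmentGadget
import Literature.Computability.FineGrained.DTWCoordinateGadget
import Literature.Computability.Cryptography.FGProblemZoo
import HarnessLib

/-!
# From Orthogonal Vectors to one-dimensional DTW: normalised vector gadgets, the final curves,
# and the threshold

The second and third levels of the reduction from Orthogonal Vectors to dynamic time warping on
one-dimensional curves (K. Bringmann, M. Künnemann, *Quadratic conditional lower bounds for
string problems and dynamic time warping*, FOCS 2015, **§3.1, proof of Thm. 3.3**, instantiated
for DTW with the alignment gadget of **Def. 6.2** (`DTWRed.ga`, file `DTWAlignmentGadget`) and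
the rigid vector gadgets of `DTWCoordinateGadget`):

* level 2, **normalised vector gadgets** (BK15 `NVG(a) = GA(S, VG(a))`, `NVG(b) = GA(VG(b))`):
  `nvgX d a = ga M₁ κ₁ [vgX 0 e, vgX 0 (a ++ [0])]`, `nvgY d b = ga M₁ κ₁ [vgY 0 (b ++ [1])]`
  with `e = 0^d 1`; **Claim 3.5**: `dtwDist (nvgX d a) (nvgY d b)` takes exactly two values,
  `ρ₀ d` if `⟨a, b⟩ = 0` and `ρ₀ d + 2` otherwise (`dtwDist_nvgX_nvgY`);
* level 3, the **final curves** of an OV instance `I = (n, d, A, B)`: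
  `ovX I = ga M₂ κ₂ [NVG a₀, …, NVG a_{n-1}, NVG a₀, …, NVG a_{n-1}]`,
  `ovY I = ga M₂ κ₂ [NVG b₀, …, NVG b_{n-1}]`, and the threshold `thr I`; **Claim 3.6** and the
  conclusion of the proof of Thm. 3.3: for `n ≥ 1`,
  `(dtwDist (ovX I) (ovY I)).toNat ≤ thr I ↔ I.HasOrthogonalPair` (`dtwDist_ov_le_thr_iff`);
* the packaging of `(ovX I, ovY I)` as an instance of the zoo problem `DTW c` (`c ≥ 1`):
  nonempty curves with entries in `[0, M₂] ⊆ [-N^c, N^c]` (`ovDTWInst`), and closed forms /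
  linear bounds for all lengths (`length_ovX`, `length_ovY`, …) for the word-RAM program.

All values are natural numbers; `M₂ = 4 z₁ = 48 d + 36`, lengths are `O((n + 1)(d + 1))`.

## References

* K. Bringmann, M. Künnemann, FOCS 2015 (arXiv:1502.01063), §3.1 (Claims 3.4–3.6, proof of
  Thm. 3.3), §6 (Def. 6.2, Lemma 6.3), Thm. 1.1.
-/

namespace Literature.Computability.FineGrained

open Cryptography

namespace DTWRed

/-! ### Parameters (functions of the dimension `d`) -/

/-- Extended dimension `d' = d + 1` (one extra coordinate, BK15 §3.1). [cite: BringmannKunnemannFOCS2015, §3.1] -/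
def dd (d : ℕ) : ℕ := d + 1
/-- Length `L = 2 d'` of a vector gadget. [folklore] -/
def Lv (d : ℕ) : ℕ := 2 * dd d
/-- Value bound `z₁ = 12 d' - 3` of the vector gadgets (base height `0`). [folklore] -/
def z₁ (d : ℕ) : ℕ := 12 * dd d - 3
/-- Level-2 separator `M₁ = 2 z₁`. [cite: BringmannKunnemannFOCS2015, Def. 6.2] -/
def M₁ (d : ℕ) : ℕ := 2 * z₁ d
/-- Level-2 block length `κ₁ = 4 (L + L) + 1`. [folklore] -/
def κ₁ (d : ℕ) : ℕ := 4 * (Lv d + Lv d) + 1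
/-- The extra vector `e = 0^d 1` (BK15's `S` is its vector gadget). [cite: BringmannKunnemannFOCS2015, §3.1] -/
def eVec (d : ℕ) : List Bool := List.replicate d false ++ [true]
/-- `x`-side vectors get the extra coordinate `0`. [cite: BringmannKunnemannFOCS2015, §3.1] -/
def extX (a : List Bool) : List Bool := a ++ [false]
/-- `y`-side vectors get the extra coordinate `1`. [cite: BringmannKunnemannFOCS2015, §3.1] -/
def extY (b : List Bool) : List Bool := b ++ [true]

/-- The common sum of the `x`-side vector gadgets of dimension `d'` at base height `0`. [folklore] -/
def sumVG (d : ℕ) : ℤ := 4 * (dd d : ℤ) + 6 * ∑ ℓ ∈ Finset.range (Lv d), ((0 : ℕ) + (ℓ : ℤ))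
/-- Level-2 skip cost `σ₁ = L M₁ - sumVG`. [cite: BringmannKunnemannFOCS2015, Lemma 6.3 (the constant C)] -/
def σ₁ (d : ℕ) : ℤ := (Lv d : ℤ) * (M₁ d : ℤ) - sumVG d
/-- The smaller of the two level-2 distances: `ρ₀ = σ₁ + 2 d'` (orthogonal pairs). [cite: BringmannKunnemannFOCS2015, Claim 3.5] -/
def ρ₀ (d : ℕ) : ℤ := σ₁ d + 2 * (dd d : ℤ)

/-! ### Level 2: normalised vector gadgets -/

/-- The `x`-side normalised vector gadget `NVG(a) = GA(S, VG(a))` (BK15 §3.1), for DTW: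
`M₁^κ₁ VG(e) M₁^κ₁ VG(a 0) M₁^κ₁`. [cite: BringmannKunnemannFOCS2015, §3.1 (normalized vector gadgets)] -/
def nvgX (d : ℕ) (a : List Bool) : List ℤ := ga (M₁ d) (κ₁ d) [vgX 0 (eVec d), vgX 0 (extX a)]

/-- The `y`-side normalised vector gadget `NVG(b) = GA(VG(b))`: `M₁^κ₁ VG(b 1) M₁^κ₁`.
[cite: BringmannKunnemannFOCS2015, §3.1 (normalized vector gadgets)] -/
def nvgY (d : ℕ) (b : List Bool) : List ℤ := ga (M₁ d) (κ₁ d) [vgY 0 (extY b)]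

section level2

variable {d : ℕ} {a b : List Bool}

/-- `e = 0^d 1` has length `d'`. [folklore] -/
@[simp] theorem length_eVec (d : ℕ) : (eVec d).length = dd d := by simp [eVec, dd]
/-- `|a 0| = |a| + 1`. [folklore] -/
@[simp] theorem length_extX (a : List Bool) : (extX a).length = a.length + 1 := by simp [extX]
/-- `|b 1| = |b| + 1`. [folklore] -/
@[simp] theorem length_extY (b : List Bool) : (extY b).length = b.length + 1 := by simp [extY]

/-- `⟨e, b1⟩ = 1`. [folklore] -/
theorem ip_eVec_extY (hb : b.length = d) : ip (eVec d) (extY b) = 1 := by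
  subst hb
  unfold eVec extY
  induction b with
  | nil => rfl
  | cons β b ih => simpa [ip, List.replicate_succ] using ih

/-- `⟨a0, b1⟩ = ⟨a, b⟩`. [folklore] -/
theorem ip_extX_extY : ∀ (a b : List Bool), a.length = b.length → ip (extX a) (extY b) = ip a b
  | [], [], _ => rfl
  | [], _ :: _, h => by simp at h
  | _ :: _, [], h => by simp at h
  | α :: a, β :: b, h => by
    have ih := ip_extX_extY a b (by simpa using h)
    unfold extX extY at ih ⊢
    simp only [List.cons_append, ip]
    rw [ih]

/-- `1 ≤ d'`, `z₁ = 12 d' - 3 ≥ 9`, `M₁ = 2 z₁`, numerics. [folklore] -/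
theorem params₁ (d : ℕ) : 1 ≤ dd d ∧ Lv d = 2 * dd d ∧ (z₁ d : ℤ) = 12 * dd d - 3 ∧ 9 ≤ z₁ d ∧
    (M₁ d : ℤ) = 2 * z₁ d ∧ κ₁ d = 4 * (Lv d + Lv d) + 1 := by
  refine ⟨by unfold dd; omega, rfl, ?_, by unfold z₁ dd; omega, by unfold M₁; push_cast; ring, rfl⟩
  unfold z₁; have : 3 ≤ 12 * dd d := by unfold dd; omega
  push_cast [this]; ring

/-- Values of a vector gadget of dimension `d'` at base height `0` lie in `[0, z₁]`. [folklore] -/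
theorem vgX_vals (ha : a.length = dd d) : ∀ w ∈ vgX 0 a, 0 ≤ w ∧ w ≤ z₁ d := by
  intro w hw
  have h := vgX_bounds 0 a w hw
  obtain ⟨-, -, hz, -⟩ := params₁ d
  rw [ha] at h; push_cast at h; constructor <;> linarith

/-- Values of a `y`-side vector gadget lie in `[0, z₁]`. [folklore] -/
theorem vgY_vals (hb : b.length = dd d) : ∀ w ∈ vgY 0 b, 0 ≤ w ∧ w ≤ z₁ d := by
  intro w hw
  have h := vgY_bounds 0 b w hw
  obtain ⟨-, -, hz, -⟩ := params₁ d
  rw [hb] at h; push_cast at h; constructor <;> linarith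

/-- The sum of an `x`-side vector gadget of dimension `d'` is `sumVG d`. [folklore] -/
theorem sum_vgX_eq (ha : a.length = dd d) : (vgX 0 a).sum = sumVG d := by
  rw [sum_vgX, ha]; unfold sumVG Lv; push_cast; rfl

/-- The skip cost of a gadget with values `≤ M`: `skipCost M X = |X| M - Σ X`. [folklore] -/
theorem skipCost_eq_of_le (M : ℤ) (X : List ℤ) (hX : ∀ v ∈ X, v ≤ M) :
    skipCost M X = (((X.length : ℤ) * M - X.sum).toNat : ℕ∞) := by
  unfold skipCost
  rw [sum_map_cost X fun _ => M]
  congr 1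
  have h : (((X.map fun v => (v - M).natAbs).sum : ℕ) : ℤ) = (X.length : ℤ) * M - X.sum := by
    rw [Nat.cast_list_sum, List.map_map]
    have : ∀ (Y : List ℤ), (∀ v ∈ Y, v ≤ M) →
        (Y.map (Nat.cast ∘ fun v => (v - M).natAbs) : List ℤ).sum = (Y.length : ℤ) * M - Y.sum := by
      intro Y hY
      induction Y with
      | nil => simp
      | cons v Y ih =>
        have hv := hY v (by simp)
        rw [List.map_cons, List.sum_cons, ih (fun w hw => hY w (by simp [hw])), List.length_cons,
          List.sum_cons]
        simp only [Function.comp_apply]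
        rw [Int.ofNat_natAbs_of_nonpos (by linarith)]
        push_cast; ring
    exact this X hX
  omega

/-- The skip cost of an `x`-side vector gadget is `σ₁`. [folklore] -/
theorem skipCost_vgX (ha : a.length = dd d) : skipCost (M₁ d) (vgX 0 a) = ((σ₁ d).toNat : ℕ∞) := by
  obtain ⟨-, hL, hz, -, hM, -⟩ := params₁ d
  rw [skipCost_eq_of_le _ _ (fun v hv => by have := (vgX_vals ha v hv).2; linarith), sum_vgX_eq ha,
    length_vgX, ha]
  unfold σ₁ Lv; rfl

/-- `σ₁ ≥ 0`. [folklore] -/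
theorem σ₁_nonneg (d : ℕ) : 0 ≤ σ₁ d := by
  have ha : (extX (List.replicate d false)).length = dd d := by simp [dd]
  have hsum := sum_vgX_eq ha
  have hlen : (vgX 0 (extX (List.replicate d false))).length = Lv d := by simp [Lv, dd]
  have hvals := vgX_vals ha
  obtain ⟨-, -, hz, -, hM, -⟩ := params₁ d
  unfold σ₁
  rw [← hsum, ← hlen]
  have : ∀ (Y : List ℤ), (∀ v ∈ Y, 0 ≤ v ∧ v ≤ z₁ d) → Y.sum ≤ (Y.length : ℤ) * (M₁ d : ℤ) := by
    intro Y hY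
    induction Y with
    | nil => simp
    | cons v Y ih =>
      have := hY v (by simp)
      rw [List.sum_cons, List.length_cons]
      have := ih (fun w hw => hY w (by simp [hw]))
      push_cast; nlinarith
  have := this _ hvals
  linarith

/-- **The level-2 setup**: the alignment gadget `GA([VG e, VG a0], [VG b1])`. [folklore] -/
def setup₂ (d : ℕ) (a b : List Bool) : GASetup where
  z := z₁ d
  κ := κ₁ d
  ℓx := Lv d
  ℓy := Lv d
  sx := sumVG d
  Xs := [vgX 0 (eVec d), vgX 0 (extX a)]
  Ys := [vgY 0 (extY b)]
  mv := fun _ => 2 * dd d + 2 * min 1 (ip a b)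

/-- The level-2 setup is well formed. [folklore] -/
theorem setup₂_wf (ha : a.length = d) (hb : b.length = d) : (setup₂ d a b).WF := by
  obtain ⟨hdd, hL, hz, hz9, hM, hκ⟩ := params₁ d
  have haX : (extX a).length = dd d := by simp [ha, dd]
  have hbY : (extY b).length = dd d := by simp [hb, dd]
  have heX : (eVec d).length = dd d := length_eVec d
  -- the two `X`-gadgets and the `Y`-gadget
  have hX : ∀ i, i < 2 → (setup₂ d a b).X i = if i = 0 then vgX 0 (eVec d) else vgX 0 (extX a) := by
    intro i hi
    rcases (show i = 0 ∨ i = 1 by omega) with rfl | rfl <;> rfl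
  have hY0 : (setup₂ d a b).Y 0 = vgY 0 (extY b) := rfl
  have hN : (setup₂ d a b).N = 2 := rfl
  have hm : (setup₂ d a b).m = 1 := rfl
  refine ⟨?_, ?_, ?_, ?_, ?_, ?_, ?_, ?_, ?_, ?_, ?_⟩
  · show 1 ≤ Lv d; omega
  · show 1 ≤ Lv d; omega
  · show 4 * (Lv d + Lv d) + 1 ≤ κ₁ d; omega
  · rw [hN]; omega
  · intro i hi; rw [hN] at hi; rw [hX i hi]
    show _ = Lv d
    split_ifs <;> simp [Lv, heX, haX]
  · intro i hi; rw [hN] at hi; rw [hX i hi]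
    show _ = sumVG d
    split_ifs
    · exact sum_vgX_eq heX
    · exact sum_vgX_eq haX
  · intro i hi; rw [hN] at hi; rw [hX i hi]
    show ∀ v ∈ _, 0 ≤ v ∧ v ≤ ((z₁ d : ℕ) : ℤ)
    split_ifs
    · exact vgX_vals heX
    · exact vgX_vals haX
  · intro j hj; rw [hm] at hj
    have : j = 0 := by omega
    subst this; rw [hY0]; show _ = Lv d; simp [Lv, hbY]
  · intro j hj; rw [hm] at hj
    have : j = 0 := by omega
    subst this; rw [hY0]; exact vgY_vals hbY
  · -- the claimed bound holds for both gadgets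
    intro i hi j hj; rw [hN] at hi; rw [hm] at hj
    have : j = 0 := by omega
    subst this
    rw [hX i hi, hY0]
    show (((2 * dd d + 2 * min 1 (ip a b) : ℕ)) : ℕ∞) ≤ _
    split_ifs
    · rw [dtwDist_vgX_vgY 0 _ _ (by rw [heX, hbY]) (by rw [heX]; exact hdd), ip_eVec_extY hb, heX]
      exact_mod_cast (by omega : 2 * dd d + 2 * min 1 (ip a b) ≤ 2 * dd d + 2 * 1)
    · rw [dtwDist_vgX_vgY 0 _ _ (by rw [haX, hbY]) (by rw [haX]; exact hdd), ip_extX_extY a b (by rw [ha, hb]), haX]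
      exact_mod_cast (by omega : 2 * dd d + 2 * min 1 (ip a b) ≤ 2 * dd d + 2 * ip a b)
  · -- … and is at most `λ₀`
    intro j hj; rw [hm] at hj
    have : j = 0 := by omega
    subst this
    show ((2 * dd d + 2 * min 1 (ip a b) : ℕ) : ℤ) ≤ ((Lv d : ℕ) : ℤ) * (2 * ((z₁ d : ℕ) : ℤ)) - (vgY 0 (extY b)).sum
    have hvals := vgY_vals hbY
    have hlen : (vgY 0 (extY b)).length = Lv d := by simp [Lv, hbY]
    have : ∀ (Y : List ℤ), (∀ v ∈ Y, 0 ≤ v ∧ v ≤ z₁ d) → Y.sum ≤ (Y.length : ℤ) * (z₁ d : ℤ) := by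
      intro Y hY
      induction Y with
      | nil => simp
      | cons v Y ih =>
        have := hY v (by simp)
        rw [List.sum_cons, List.length_cons]
        have := ih (fun w hw => hY w (by simp [hw]))
        push_cast; nlinarith
    have hs := this _ hvals
    rw [hlen] at hs
    have hmin : min 1 (ip a b) ≤ 1 := min_le_left _ _
    have h2 : ((2 * dd d + 2 * min 1 (ip a b) : ℕ) : ℤ) ≤ 2 * dd d + 2 := by push_cast; omega
    rw [hL] at hs ⊢
    push_cast at hs ⊢
    nlinarith

/-- **Claim 3.5 for DTW (the two values of the normalised vector gadgets).** For `|a| = |b| = d`,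
`dtwDist (nvgX d a) (nvgY d b) = σ₁ + 2 d' + 2 · min 1 ⟨a, b⟩`, i.e. `ρ₀ d` if `a ⊥ b` and
`ρ₀ d + 2` otherwise. (Upper bound: the structured traversals with shift `0` — couple `VG(b1)`
with `VG(e)`, cost `2d' + 2` — and shift `1` — couple it with `VG(a0)`, cost `2d' + 2⟨a,b⟩`;
lower bound: the alignment-gadget lower bound with this minimum as the claimed bound.)
[cite: BringmannKunnemannFOCS2015, Claim 3.5] -/
theorem dtwDist_nvgX_nvgY (ha : a.length = d) (hb : b.length = d) :
    dtwDist (nvgX d a) (nvgY d b) = (((σ₁ d).toNat + (2 * dd d + 2 * min 1 (ip a b)) : ℕ) : ℕ∞) := by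
  obtain ⟨hdd, hL, hz, hz9, hM, hκ⟩ := params₁ d
  have haX : (extX a).length = dd d := by simp [ha, dd]
  have hbY : (extY b).length = dd d := by simp [hb, dd]
  have heX : (eVec d).length = dd d := length_eVec d
  have hκ1 : 1 ≤ κ₁ d := by omega
  have hσ := σ₁_nonneg d
  refine le_antisymm ?_ ?_
  · -- upper bound: shift 0 or shift 1
    unfold nvgX nvgY
    by_cases hip : ip a b = 0
    · -- shift 1: skip `VG e`, couple `VG(a0)` with `VG(b1)`
      have h := dtwDist_ga_ga_le_shift ((M₁ d : ℕ) : ℤ) hκ1 [vgX 0 (eVec d), vgX 0 (extX a)] [vgY 0 (extY b)] 1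
        (by simp)
      simp only [List.take_succ_cons, List.take_zero, List.map_cons, List.map_nil, List.sum_cons,
        List.sum_nil, add_zero, List.drop_succ_cons, List.drop_zero, List.zipWith_cons_cons,
        List.zipWith_nil_right, List.length_singleton, List.drop_nil] at h
      rw [skipCost_vgX heX, dtwDist_vgX_vgY 0 _ _ (by rw [haX, hbY]) (by rw [haX]; exact hdd),
        ip_extX_extY a b (by rw [ha, hb]), haX, hip] at h
      refine h.trans (le_of_eq ?_)
      rw [hip]; simp
    · -- shift 0: couple `VG e` with `VG(b1)`, skip `VG(a0)`
      have h := dtwDist_ga_ga_le_shift ((M₁ d : ℕ) : ℤ) hκ1 [vgX 0 (eVec d), vgX 0 (extX a)] [vgY 0 (extY b)] 0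
        (by simp)
      simp only [List.take_zero, List.map_nil, List.sum_nil, zero_add, List.drop_zero,
        List.zipWith_cons_cons, List.zipWith_nil_right, List.sum_cons, List.sum_nil, add_zero,
        List.length_singleton, List.drop_succ_cons, List.map_cons] at h
      rw [skipCost_vgX haX, dtwDist_vgX_vgY 0 _ _ (by rw [heX, hbY]) (by rw [heX]; exact hdd),
        ip_eVec_extY hb, heX] at h
      refine h.trans (le_of_eq ?_)
      rw [min_eq_left (by omega : 1 ≤ ip a b)]; push_cast; ring
  · -- lower bound: the alignment gadget with claimed bound `2d' + 2 min 1 ⟨a,b⟩`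
    have hW := setup₂_wf ha hb
    have h := GASetup.le_dtwDist_ga_ga hW ((σ₁ d).toNat + (2 * dd d + 2 * min 1 (ip a b))) (by
      show (((σ₁ d).toNat + (2 * dd d + 2 * min 1 (ip a b)) : ℕ) : ℤ) ≤
        (∑ k ∈ Finset.range 1, ((2 * dd d + 2 * min 1 (ip a b) : ℕ) : ℤ)) +
          (((Lv d : ℕ) : ℤ) * (2 * ((z₁ d : ℕ) : ℤ)) - sumVG d) * ((2 - 1 : ℕ) : ℤ)
      have e1 : σ₁ d = ((Lv d : ℕ) : ℤ) * (2 * ((z₁ d : ℕ) : ℤ)) - sumVG d := by unfold σ₁; rw [hM]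
      rw [Finset.sum_range_one, show (2 - 1 : ℕ) = 1 from rfl]
      push_cast
      rw [Int.toNat_of_nonneg hσ]
      linarith)
    exact h

end level2


/-! ### Level 3: the curves of an OV instance -/

/-- Length `ℓx = 3 κ₁ + 2 L` of an `x`-side normalised vector gadget. [folklore] -/
def ℓx₃ (d : ℕ) : ℕ := 3 * κ₁ d + 2 * Lv d
/-- Length `ℓy = 2 κ₁ + L` of a `y`-side normalised vector gadget. [folklore] -/
def ℓy₃ (d : ℕ) : ℕ := 2 * κ₁ d + Lv d
/-- Level-3 separator `M₂ = 2 M₁` (the level-3 value bound is `z₂ = M₁`). [cite: BringmannKunnemannFOCS2015, Def. 6.2] -/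
def M₂ (d : ℕ) : ℕ := 2 * M₁ d
/-- Level-3 block length `κ₂ = 4 (ℓx + ℓy) + 1`. [folklore] -/
def κ₂ (d : ℕ) : ℕ := 4 * (ℓx₃ d + ℓy₃ d) + 1
/-- The common sum `3 κ₁ M₁ + 2 sumVG` of the `x`-side normalised vector gadgets. [folklore] -/
def sumNVG (d : ℕ) : ℤ := 3 * (κ₁ d : ℤ) * (M₁ d : ℤ) + 2 * sumVG d
/-- Level-3 skip cost `σ₃ = ℓx M₂ - sumNVG`. [cite: BringmannKunnemannFOCS2015, Lemma 6.3 (the constant C)] -/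
def σ₃ (d : ℕ) : ℤ := (ℓx₃ d : ℤ) * (M₂ d : ℤ) - sumNVG d
/-- `ρ₀' = σ₁ + 2 d'`, the level-2 distance of an orthogonal pair, as a natural number.
[cite: BringmannKunnemannFOCS2015, Claim 3.5] -/
def ρ₀N (d : ℕ) : ℕ := (σ₁ d).toNat + 2 * dd d
/-- `ρ₁' = ρ₀' + 2`, the level-2 distance of a non-orthogonal pair. [cite: BringmannKunnemannFOCS2015, Claim 3.5] -/
def ρ₁N (d : ℕ) : ℕ := (σ₁ d).toNat + (2 * dd d + 2)

/-- The `i`-th vector of the first list as a bit list. [folklore] -/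
def aVec (I : OVInstance) (i : Fin I.n) : List Bool := List.ofFn (I.A i)
/-- The `j`-th vector of the second list as a bit list. [folklore] -/
def bVec (I : OVInstance) (j : Fin I.n) : List Bool := List.ofFn (I.B j)

/-- Index `k < 2n ↦ k mod n`. [folklore] -/
def modIdx (I : OVInstance) (k : Fin (2 * I.n)) : Fin I.n :=
  ⟨k.1 % I.n, Nat.mod_lt _ (by have := k.2; omega)⟩

/-- The `2n` `x`-side gadgets `NVG a₀, …, NVG a_{n-1}, NVG a₀, …, NVG a_{n-1}` (BK15 §3.1: the
list of `NVG(aᵢ)` twice, so that every cyclic shift is a structured alignment).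
[cite: BringmannKunnemannFOCS2015, §3.1 (definition of x)] -/
def XsOV (I : OVInstance) : List (List ℤ) :=
  (List.finRange (2 * I.n)).map fun k => nvgX I.d (aVec I (modIdx I k))

/-- The `n` `y`-side gadgets `NVG b₀, …, NVG b_{n-1}`. [cite: BringmannKunnemannFOCS2015, §3.1 (definition of y)] -/
def YsOV (I : OVInstance) : List (List ℤ) :=
  (List.finRange I.n).map fun j => nvgY I.d (bVec I j)

/-- **The first curve** `x = GA(NVG a₀, …, NVG a_{n-1}, NVG a₀, …, NVG a_{n-1})` of the DTW
instance of an OV instance. [cite: BringmannKunnemannFOCS2015, §3.1 and Def. 6.2] -/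
def ovX (I : OVInstance) : List ℤ := ga (M₂ I.d) (κ₂ I.d) (XsOV I)

/-- **The second curve** `y = GA(NVG b₀, …, NVG b_{n-1})`. [cite: BringmannKunnemannFOCS2015, §3.1 and Def. 6.2] -/
def ovY (I : OVInstance) : List ℤ := ga (M₂ I.d) (κ₂ I.d) (YsOV I)

/-- **The threshold** `ρ = n σ₃ + (n - 1) ρ₁' + ρ₀'` (BK15, end of the proof of Thm. 3.3:
`ρ = C'' + (m-1) ρ₁' + ρ₀'` with `C'' = (2n - n) σ₃`). [cite: BringmannKunnemannFOCS2015, §3.1 (proof of Thm. 3.3, the threshold ρ)] -/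
def thr (I : OVInstance) : ℕ := I.n * (σ₃ I.d).toNat + (I.n - 1) * ρ₁N I.d + ρ₀N I.d

section level3

variable {d : ℕ} {a b : List Bool}

/-- The sum of an alignment-gadget curve. [folklore] -/
theorem sum_ga (M : ℤ) (κ : ℕ) : ∀ Xs : List (List ℤ),
    (ga M κ Xs).sum = (((Xs.length + 1) * κ : ℕ) : ℤ) * M + (Xs.map List.sum).sum
  | [] => by simp [ga]
  | X :: Xs => by
    rw [ga_cons, List.sum_append, List.sum_append, List.sum_replicate, sum_ga M κ Xs,
      List.map_cons, List.sum_cons, List.length_cons]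
    push_cast; simp; ring

/-- Length of an `x`-side normalised vector gadget. [folklore] -/
theorem length_nvgX (ha : a.length = d) : (nvgX d a).length = ℓx₃ d := by
  unfold nvgX; rw [length_ga]; simp [ℓx₃, Lv, dd, ha]; ring

/-- Length of a `y`-side normalised vector gadget. [folklore] -/
theorem length_nvgY (hb : b.length = d) : (nvgY d b).length = ℓy₃ d := by
  unfold nvgY; rw [length_ga]; simp [ℓy₃, Lv, dd, hb]; ring

/-- The sum of an `x`-side normalised vector gadget does not depend on the vector. [folklore] -/
theorem sum_nvgX (ha : a.length = d) : (nvgX d a).sum = sumNVG d := by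
  unfold nvgX; rw [sum_ga]
  simp only [List.length_cons, List.length_nil, List.map_cons, List.map_nil, List.sum_cons,
    List.sum_nil, add_zero]
  rw [sum_vgX_eq (length_eVec d), sum_vgX_eq (show (extX a).length = dd d by simp [ha, dd])]
  unfold sumNVG; push_cast; ring

/-- Values of an `x`-side normalised vector gadget lie in `[0, M₁]`. [folklore] -/
theorem nvgX_vals (ha : a.length = d) : ∀ w ∈ nvgX d a, 0 ≤ w ∧ w ≤ M₁ d := by
  obtain ⟨-, -, hz, hz9, hM, hκ⟩ := params₁ d
  intro w hw
  unfold nvgX at hw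
  rcases (mem_ga_iff _ (by omega) _ w).1 hw with rfl | ⟨X, hX, hwX⟩
  · constructor <;> linarith
  · simp only [List.mem_cons, List.not_mem_nil, or_false] at hX
    rcases hX with rfl | rfl
    · have := vgX_vals (length_eVec d) w hwX; constructor <;> linarith
    · have := vgX_vals (show (extX a).length = dd d by simp [ha, dd]) w hwX; constructor <;> linarith

/-- Values of a `y`-side normalised vector gadget lie in `[0, M₁]`. [folklore] -/
theorem nvgY_vals (hb : b.length = d) : ∀ w ∈ nvgY d b, 0 ≤ w ∧ w ≤ M₁ d := by
  obtain ⟨-, -, hz, hz9, hM, hκ⟩ := params₁ d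
  intro w hw
  unfold nvgY at hw
  rcases (mem_ga_iff _ (by omega) _ w).1 hw with rfl | ⟨X, hX, hwX⟩
  · constructor <;> linarith
  · simp only [List.mem_cons, List.not_mem_nil, or_false] at hX
    subst hX
    have := vgY_vals (show (extY b).length = dd d by simp [hb, dd]) w hwX; constructor <;> linarith

/-- The sum of a `y`-side normalised vector gadget is at most `2 κ₁ M₁ + L z₁`. [folklore] -/
theorem sum_nvgY_le (hb : b.length = d) : (nvgY d b).sum ≤ 2 * (κ₁ d : ℤ) * M₁ d + (Lv d : ℤ) * z₁ d := by
  unfold nvgY; rw [sum_ga]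
  simp only [List.length_cons, List.length_nil, List.map_cons, List.map_nil, List.sum_cons,
    List.sum_nil, add_zero]
  have hbY : (extY b).length = dd d := by simp [hb, dd]
  have hvals := vgY_vals hbY
  have hlen : (vgY 0 (extY b)).length = Lv d := by simp [Lv, hbY]
  have : ∀ (Y : List ℤ), (∀ v ∈ Y, 0 ≤ v ∧ v ≤ z₁ d) → Y.sum ≤ (Y.length : ℤ) * (z₁ d : ℤ) := by
    intro Y hY
    induction Y with
    | nil => simp
    | cons v Y ih =>
      have := hY v (by simp)
      rw [List.sum_cons, List.length_cons]
      have := ih (fun w hw => hY w (by simp [hw]))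
      push_cast; nlinarith
  have hs := this _ hvals
  rw [hlen] at hs
  push_cast; linarith

/-- The skip cost of an `x`-side normalised vector gadget is `σ₃` (and `σ₃ ≥ 0`). [folklore] -/
theorem skipCost_nvgX (ha : a.length = d) :
    skipCost (M₂ d) (nvgX d a) = ((σ₃ d).toNat : ℕ∞) ∧ 0 ≤ σ₃ d := by
  have hvals := nvgX_vals ha
  have hM2 : ((M₂ d : ℕ) : ℤ) = 2 * ((M₁ d : ℕ) : ℤ) := by unfold M₂; push_cast; ring
  have hle : ∀ v ∈ nvgX d a, v ≤ ((M₂ d : ℕ) : ℤ) := fun v hv => by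
    have := (hvals v hv).2; rw [hM2]; linarith
  have e : (((nvgX d a).length : ℕ) : ℤ) * ((M₂ d : ℕ) : ℤ) - (nvgX d a).sum = σ₃ d := by
    rw [length_nvgX ha, sum_nvgX ha]; rfl
  have hsum : ∀ (Y : List ℤ), (∀ v ∈ Y, 0 ≤ v ∧ v ≤ ((M₁ d : ℕ) : ℤ)) →
      Y.sum ≤ (Y.length : ℤ) * ((M₁ d : ℕ) : ℤ) := by
    intro Y hY
    induction Y with
    | nil => simp
    | cons v Y ih =>
      have h1 := hY v (by simp)
      rw [List.sum_cons, List.length_cons]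
      have h2 := ih (fun w hw => hY w (by simp [hw]))
      push_cast; nlinarith
  have hs := hsum _ hvals
  rw [length_nvgX ha, sum_nvgX ha] at hs
  refine ⟨by rw [skipCost_eq_of_le _ _ hle, e], ?_⟩
  have e' : σ₃ d = ((ℓx₃ d : ℕ) : ℤ) * (2 * ((M₁ d : ℕ) : ℤ)) - sumNVG d := by
    rw [← e, length_nvgX ha, sum_nvgX ha, hM2]
  have h0 : (0 : ℤ) ≤ ((ℓx₃ d : ℕ) : ℤ) * ((M₁ d : ℕ) : ℤ) :=
    mul_nonneg (Nat.cast_nonneg _) (Nat.cast_nonneg _)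
  rw [e']; linarith

/-- `⟨a, b⟩ = 0` for the bit lists of two vectors iff they are orthogonal. [folklore] -/
theorem ip_aVec_bVec_eq_zero_iff (I : OVInstance) (i j : Fin I.n) :
    ip (aVec I i) (bVec I j) = 0 ↔ AreOrthogonal (I.A i) (I.B j) := by
  unfold aVec bVec AreOrthogonal
  rw [ip_eq_zero_iff _ _ (by simp)]
  simp only [List.length_ofFn, List.getElem_ofFn]
  constructor
  · intro h k; exact h k k.2
  · intro h k hk; exact h ⟨k, hk⟩

/-- Lengths of the vector lists. [folklore] -/
@[simp] theorem length_aVec (I : OVInstance) (i : Fin I.n) : (aVec I i).length = I.d := by simp [aVec]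
/-- Lengths of the vector lists. [folklore] -/
@[simp] theorem length_bVec (I : OVInstance) (j : Fin I.n) : (bVec I j).length = I.d := by simp [bVec]
/-- `|XsOV I| = 2n`. [folklore] -/
@[simp] theorem length_XsOV (I : OVInstance) : (XsOV I).length = 2 * I.n := by simp [XsOV]
/-- `|YsOV I| = n`. [folklore] -/
@[simp] theorem length_YsOV (I : OVInstance) : (YsOV I).length = I.n := by simp [YsOV]

/-- The gadgets of the first list, by index. [folklore] -/
theorem getElem_XsOV (I : OVInstance) {k : ℕ} (hk : k < (XsOV I).length) :
    (XsOV I)[k] = nvgX I.d (aVec I (modIdx I ⟨k, by simpa using hk⟩)) := by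
  unfold XsOV; simp

/-- The gadgets of the second list, by index. [folklore] -/
theorem getElem_YsOV (I : OVInstance) {j : ℕ} (hj : j < (YsOV I).length) :
    (YsOV I)[j] = nvgY I.d (bVec I ⟨j, by simpa using hj⟩) := by
  unfold YsOV; simp

/-- Every gadget of the first list is some `NVG aᵢ`. [folklore] -/
theorem mem_XsOV (I : OVInstance) {X : List ℤ} (hX : X ∈ XsOV I) : ∃ i : Fin I.n, X = nvgX I.d (aVec I i) := by
  unfold XsOV at hX
  simp only [List.mem_map, List.mem_finRange, true_and] at hX
  obtain ⟨k, rfl⟩ := hX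
  exact ⟨_, rfl⟩

/-- **The level-3 setup** (claimed bound: the non-orthogonal value `ρ₁'` for every column).
[folklore] -/
def setup₃ (I : OVInstance) : GASetup where
  z := M₁ I.d
  κ := κ₂ I.d
  ℓx := ℓx₃ I.d
  ℓy := ℓy₃ I.d
  sx := sumNVG I.d
  Xs := XsOV I
  Ys := YsOV I
  mv := fun _ => ρ₁N I.d

/-- Without an orthogonal pair the level-3 setup is well formed: every column's claimed bound
`ρ₁'` is attained by every gadget pair (Claim 3.5) and is below the column's skip cost.
[cite: BringmannKunnemannFOCS2015, Claim 3.6 (first half)] -/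
theorem setup₃_wf (I : OVInstance) (hn : 1 ≤ I.n) (hno : ¬ I.HasOrthogonalPair) : (setup₃ I).WF := by
  obtain ⟨hdd, hL, hz, hz9, hM, hκ⟩ := params₁ I.d
  have hN : (setup₃ I).N = 2 * I.n := length_XsOV I
  have hm : (setup₃ I).m = I.n := length_YsOV I
  have hX : ∀ i, i < 2 * I.n → ∃ i' : Fin I.n, (setup₃ I).X i = nvgX I.d (aVec I i') := fun i hi => by
    show ∃ i' : Fin I.n, (XsOV I).getD i [] = _
    rw [List.getD_eq_getElem _ _ (by simpa using hi), getElem_XsOV]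
    exact ⟨_, rfl⟩
  have hY : ∀ j (hj : j < I.n), (setup₃ I).Y j = nvgY I.d (bVec I ⟨j, hj⟩) := fun j hj => by
    show (YsOV I).getD j [] = _
    rw [List.getD_eq_getElem _ _ (by simpa using hj), getElem_YsOV]
  have hσ := σ₁_nonneg I.d
  refine ⟨?_, ?_, ?_, ?_, ?_, ?_, ?_, ?_, ?_, ?_, ?_⟩
  · show 1 ≤ ℓx₃ I.d; unfold ℓx₃; omega
  · show 1 ≤ ℓy₃ I.d; unfold ℓy₃; omega
  · show 4 * (ℓx₃ I.d + ℓy₃ I.d) + 1 ≤ κ₂ I.d; unfold κ₂; omega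
  · rw [hN]; omega
  · intro i hi; rw [hN] at hi
    obtain ⟨i', e⟩ := hX i hi; rw [e]; exact length_nvgX (length_aVec I i')
  · intro i hi; rw [hN] at hi
    obtain ⟨i', e⟩ := hX i hi; rw [e]; exact sum_nvgX (length_aVec I i')
  · intro i hi; rw [hN] at hi
    obtain ⟨i', e⟩ := hX i hi; rw [e]
    exact fun v hv => nvgX_vals (length_aVec I i') v hv
  · intro j hj; rw [hm] at hj; rw [hY j hj]; exact length_nvgY (length_bVec I _)
  · intro j hj; rw [hm] at hj; rw [hY j hj]; exact fun v hv => nvgY_vals (length_bVec I _) v hv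
  · intro i hi j hj; rw [hN] at hi; rw [hm] at hj
    obtain ⟨i', e⟩ := hX i hi
    rw [e, hY j hj]
    show ((ρ₁N I.d : ℕ) : ℕ∞) ≤ _
    rw [dtwDist_nvgX_nvgY (length_aVec I i') (length_bVec I _)]
    have hip : 1 ≤ ip (aVec I i') (bVec I ⟨j, hj⟩) := by
      rw [Nat.one_le_iff_ne_zero, Ne, ip_aVec_bVec_eq_zero_iff]
      exact fun h => hno ⟨i', ⟨j, hj⟩, h⟩
    rw [min_eq_left hip]; unfold ρ₁N; rfl
  · intro j hj; rw [hm] at hj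
    show ((ρ₁N I.d : ℕ) : ℤ) ≤ ((ℓy₃ I.d : ℕ) : ℤ) * (2 * ((M₁ I.d : ℕ) : ℤ)) - ((setup₃ I).Y j).sum
    rw [hY j hj]
    have hs := sum_nvgY_le (length_bVec I ⟨j, hj⟩)
    have hℓ : ((ℓy₃ I.d : ℕ) : ℤ) = 2 * κ₁ I.d + Lv I.d := by unfold ℓy₃; push_cast; ring
    have hρ : ((ρ₁N I.d : ℕ) : ℤ) = σ₁ I.d + 2 * dd I.d + 2 := by
      unfold ρ₁N; push_cast; rw [Int.toNat_of_nonneg hσ]; ring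
    have hσle : σ₁ I.d ≤ (Lv I.d : ℤ) * M₁ I.d := by
      unfold σ₁
      have : 0 ≤ sumVG I.d := by
        rw [← sum_vgX_eq (length_eVec I.d)]
        exact List.sum_nonneg fun v hv => (vgX_vals (length_eVec I.d) v hv).1
      linarith
    rw [hρ, hℓ]
    rw [hL] at hσle hs ⊢
    push_cast at hσle hs ⊢
    have hκ0 : (0 : ℤ) ≤ κ₁ I.d := by positivity
    have hd1 : (1 : ℤ) ≤ dd I.d := by exact_mod_cast hdd
    nlinarith

end level3


/-! ### The threshold theorem -/

section main

variable (I : OVInstance)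

/-- Numerics of the level-3 parameters. [folklore] -/
theorem params₃ (d : ℕ) : 1 ≤ κ₂ d ∧ ((M₂ d : ℕ) : ℤ) = 2 * ((M₁ d : ℕ) : ℤ) ∧ M₂ d ≤ κ₂ d ∧
    ℓx₃ d = 52 * dd d + 3 ∧ ℓy₃ d = 34 * dd d + 2 ∧ κ₂ d = 344 * dd d + 21 := by
  have h1 : ℓx₃ d = 52 * dd d + 3 := by unfold ℓx₃ κ₁ Lv; ring
  have h2 : ℓy₃ d = 34 * dd d + 2 := by unfold ℓy₃ κ₁ Lv; ring
  have h3 : κ₂ d = 344 * dd d + 21 := by unfold κ₂; rw [h1, h2]; ring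
  refine ⟨by rw [h3]; omega, by unfold M₂; push_cast; ring, ?_, h1, h2, h3⟩
  rw [h3]; unfold M₂ M₁ z₁; omega

/-- The skip costs of a list of `x`-side gadgets of the instance add up. [folklore] -/
theorem sum_skipCost_of_subset {l : List (List ℤ)} (hl : ∀ X ∈ l, X ∈ XsOV I) :
    (l.map (skipCost (M₂ I.d))).sum = (l.length : ℕ∞) * ((σ₃ I.d).toNat : ℕ∞) := by
  rw [List.sum_eq_card_nsmul _ (((σ₃ I.d).toNat : ℕ∞)) ?_, List.length_map, nsmul_eq_mul]
  intro x hx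
  obtain ⟨X, hX, rfl⟩ := List.mem_map.1 hx
  obtain ⟨i, rfl⟩ := mem_XsOV I (hl X hX)
  exact (skipCost_nvgX (length_aVec I i)).1

/-- The coupled part of a structured alignment, as a function of the column. [folklore] -/
theorem zipWith_drop_eq_ofFn {Δ : ℕ} (hΔ : Δ + I.n ≤ 2 * I.n) :
    List.zipWith dtwDist ((XsOV I).drop Δ) (YsOV I) =
      List.ofFn fun j : Fin I.n =>
        dtwDist (nvgX I.d (aVec I (modIdx I ⟨Δ + j, by omega⟩))) (nvgY I.d (bVec I j)) := by
  apply List.ext_getElem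
  · simp; omega
  · intro k hk hk'
    simp only [List.length_ofFn] at hk'
    rw [List.getElem_zipWith, List.getElem_drop, getElem_XsOV, getElem_YsOV, List.getElem_ofFn]

/-- **Claim 3.6, easy half: an orthogonal pair gives a cheap structured traversal.** If
`aᵢ ⊥ bⱼ`, the structured alignment with the shift `Δ ≡ i - j (mod n)` couples `NVG bⱼ` with a
copy of `NVG aᵢ` (cost `ρ₀'`) and every other column with some `NVG a` (cost `≤ ρ₁'`), so
`dtwDist x y ≤ n σ₃ + (n-1) ρ₁' + ρ₀' = thr`. [cite: BringmannKunnemannFOCS2015, Claim 3.6] -/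
theorem dtwDist_ov_le_thr (hn : 1 ≤ I.n) (h : I.HasOrthogonalPair) :
    dtwDist (ovX I) (ovY I) ≤ (thr I : ℕ∞) := by
  obtain ⟨i₀, j₀, horth⟩ := h
  obtain ⟨hκ, hM2, -, -⟩ := params₃ I.d
  -- the shift
  obtain ⟨Δ, hΔ'⟩ : ∃ Δ, Δ = ((i₀ : ℕ) + I.n - j₀) % I.n := ⟨_, rfl⟩
  have hΔn : Δ < I.n := by rw [hΔ']; exact Nat.mod_lt _ (by omega)
  have hmod : (Δ + (j₀ : ℕ)) % I.n = i₀ := by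
    rw [hΔ', Nat.mod_add_mod, show (i₀ : ℕ) + I.n - j₀ + j₀ = i₀ + I.n by omega, Nat.add_mod_right,
      Nat.mod_eq_of_lt i₀.2]
  have hub := dtwDist_ga_ga_le_shift ((M₂ I.d : ℕ) : ℤ) hκ (XsOV I) (YsOV I) Δ (by simp; omega)
  refine hub.trans ?_
  -- the three parts
  rw [sum_skipCost_of_subset I (fun X hX => List.mem_of_mem_take hX),
    sum_skipCost_of_subset I (fun X hX => List.mem_of_mem_drop hX), List.length_take, List.length_drop,
    length_XsOV, length_YsOV, min_eq_left (by omega), zipWith_drop_eq_ofFn I (by omega),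
    List.sum_ofFn]
  -- the coupled part, column by column
  have hcol : ∀ j : Fin I.n,
      dtwDist (nvgX I.d (aVec I (modIdx I ⟨Δ + j, by omega⟩))) (nvgY I.d (bVec I j)) =
        (((σ₁ I.d).toNat + (2 * dd I.d + 2 * min 1 (ip (aVec I (modIdx I ⟨Δ + j, by omega⟩)) (bVec I j))) : ℕ) : ℕ∞) :=
    fun j => dtwDist_nvgX_nvgY (length_aVec I _) (length_bVec I _)
  simp only [hcol]
  rw [← Nat.cast_sum]
  -- the column `j₀` is the orthogonal pair
  have hj₀ : ip (aVec I (modIdx I ⟨Δ + j₀, by omega⟩)) (bVec I j₀) = 0 := by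
    have : modIdx I ⟨Δ + j₀, by omega⟩ = i₀ := by
      apply Fin.ext; show (Δ + (j₀ : ℕ)) % I.n = i₀; exact hmod
    rw [this, ip_aVec_bVec_eq_zero_iff]; exact horth
  have hsum : (∑ j : Fin I.n, ((σ₁ I.d).toNat + (2 * dd I.d + 2 * min 1 (ip (aVec I (modIdx I ⟨Δ + j, by omega⟩)) (bVec I j))))) ≤
      (I.n - 1) * ρ₁N I.d + ρ₀N I.d := by
    rw [← Finset.add_sum_erase _ _ (Finset.mem_univ j₀), hj₀]
    have hrest : (∑ j ∈ Finset.univ.erase j₀, ((σ₁ I.d).toNat + (2 * dd I.d + 2 * min 1 (ip (aVec I (modIdx I ⟨Δ + j, by omega⟩)) (bVec I j))))) ≤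
        (Finset.univ.erase j₀).card • ρ₁N I.d := by
      refine Finset.sum_le_card_nsmul _ _ _ fun j _ => ?_
      unfold ρ₁N; have := min_le_left 1 (ip (aVec I (modIdx I ⟨Δ + j, by omega⟩)) (bVec I j)); omega
    rw [Finset.card_erase_of_mem (Finset.mem_univ _), Finset.card_univ, Fintype.card_fin, smul_eq_mul] at hrest
    unfold ρ₀N; simp only [min_eq_right (Nat.zero_le 1), mul_zero, add_zero]
    linarith
  -- assemble
  have htot : ((Δ : ℕ) : ℕ∞) * ((σ₃ I.d).toNat : ℕ∞) +
      ((∑ j : Fin I.n, ((σ₁ I.d).toNat + (2 * dd I.d + 2 * min 1 (ip (aVec I (modIdx I ⟨Δ + j, by omega⟩)) (bVec I j)))) : ℕ) : ℕ∞) +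
      ((2 * I.n - (Δ + I.n) : ℕ) : ℕ∞) * ((σ₃ I.d).toNat : ℕ∞) ≤ (thr I : ℕ∞) := by
    have key : Δ * (σ₃ I.d).toNat + ((I.n - 1) * ρ₁N I.d + ρ₀N I.d) + (2 * I.n - (Δ + I.n)) * (σ₃ I.d).toNat = thr I := by
      unfold thr
      have : Δ * (σ₃ I.d).toNat + (2 * I.n - (Δ + I.n)) * (σ₃ I.d).toNat = I.n * (σ₃ I.d).toNat := by
        rw [← Nat.add_mul]; congr 1; omega
      omega
    calc _ ≤ ((Δ * (σ₃ I.d).toNat + ((I.n - 1) * ρ₁N I.d + ρ₀N I.d) + (2 * I.n - (Δ + I.n)) * (σ₃ I.d).toNat : ℕ) : ℕ∞) := by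
          push_cast; gcongr; exact_mod_cast hsum
      _ = (thr I : ℕ∞) := by rw [key]
  exact htot

/-- **Claim 3.6, hard half: without an orthogonal pair every traversal is expensive.** Every
column's claimed bound is `ρ₁'` (Claim 3.5), so the alignment-gadget lower bound gives
`dtwDist x y ≥ n σ₃ + n ρ₁' = thr + 2`. [cite: BringmannKunnemannFOCS2015, Claim 3.6] -/
theorem thr_add_two_le_dtwDist_ov (hn : 1 ≤ I.n) (h : ¬ I.HasOrthogonalPair) :
    ((thr I + 2 : ℕ) : ℕ∞) ≤ dtwDist (ovX I) (ovY I) := by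
  have hW := setup₃_wf I hn h
  obtain ⟨-, hM2, -⟩ := params₃ I.d
  obtain ⟨-, hσ3⟩ := skipCost_nvgX (length_aVec I ⟨0, hn⟩)
  have hσ1 := σ₁_nonneg I.d
  have hlb := GASetup.le_dtwDist_ga_ga hW (thr I + 2) ?_
  · have hM : (setup₃ I).M = ((M₂ I.d : ℕ) : ℤ) := by rw [hM2]; rfl
    rw [hM] at hlb; exact hlb
  · show ((thr I + 2 : ℕ) : ℤ) ≤ (∑ k ∈ Finset.range (YsOV I).length, ((ρ₁N I.d : ℕ) : ℤ)) +
      (((ℓx₃ I.d : ℕ) : ℤ) * (2 * ((M₁ I.d : ℕ) : ℤ)) - sumNVG I.d) * (((XsOV I).length - (YsOV I).length : ℕ) : ℤ)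
    rw [length_XsOV, length_YsOV, Finset.sum_const, Finset.card_range, nsmul_eq_mul,
      show 2 * I.n - I.n = I.n by omega, ← hM2, show ((ℓx₃ I.d : ℕ) : ℤ) * ((M₂ I.d : ℕ) : ℤ) - sumNVG I.d = σ₃ I.d from rfl]
    unfold thr ρ₁N ρ₀N
    obtain ⟨k, hk⟩ := Nat.exists_eq_add_of_le hn
    rw [hk, show 1 + k - 1 = k by omega]
    push_cast
    rw [Int.toNat_of_nonneg hσ3, Int.toNat_of_nonneg hσ1]
    nlinarith [hσ3, hσ1]

/-- **The threshold theorem (Bringmann–Künnemann, FOCS 2015, proof of Thm. 3.3, conclusion, for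
DTW).** For an OV instance with `n ≥ 1`: `dtwDist (ovX I) (ovY I) ≤ thr I ↔ I` has an orthogonal
pair. [cite: BringmannKunnemannFOCS2015, Thm. 3.3 (proof, §3.1)] -/
theorem dtwDist_ov_le_thr_iff (hn : 1 ≤ I.n) : dtwDist (ovX I) (ovY I) ≤ (thr I : ℕ∞) ↔ I.HasOrthogonalPair := by
  refine ⟨fun h => ?_, dtwDist_ov_le_thr I hn⟩
  by_contra hno
  have h2 := (thr_add_two_le_dtwDist_ov I hn hno).trans h
  have : thr I + 2 ≤ thr I := by exact_mod_cast h2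
  omega

/-- The distance of the two curves is finite. [folklore] -/
theorem dtwDist_ov_ne_top : dtwDist (ovX I) (ovY I) ≠ ⊤ := by
  obtain ⟨hκ, -⟩ := params₃ I.d
  exact dtwDist_ne_top (ga_ne_nil _ hκ _) (ga_ne_nil _ hκ _)

/-- The threshold theorem for the natural-number output of a DTW algorithm:
`(dtwDist x y).toNat ≤ thr I ↔ I.HasOrthogonalPair` (`n ≥ 1`). [cite: BringmannKunnemannFOCS2015, Thm. 3.3 (proof, §3.1)] -/
theorem toNat_dtwDist_ov_le_thr_iff (hn : 1 ≤ I.n) :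
    (dtwDist (ovX I) (ovY I)).toNat ≤ thr I ↔ I.HasOrthogonalPair := by
  rw [← dtwDist_ov_le_thr_iff I hn, ← ENat.coe_toNat (dtwDist_ov_ne_top I), ENat.coe_le_coe, ENat.toNat_coe]

end main

/-! ### The DTW instance of an OV instance -/

section packaging

variable (I : OVInstance)

/-- Length of the first curve. [folklore] -/
theorem length_ovX : (ovX I).length = κ₂ I.d + 2 * I.n * (ℓx₃ I.d + κ₂ I.d) := by
  unfold ovX; rw [length_ga]
  have : ((XsOV I).map fun X => X.length + κ₂ I.d) = (XsOV I).map fun _ => ℓx₃ I.d + κ₂ I.d := by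
    refine List.map_congr_left fun X hX => ?_
    obtain ⟨i, rfl⟩ := mem_XsOV I hX
    rw [length_nvgX (length_aVec I i)]
  rw [this, List.map_const', List.sum_replicate, length_XsOV, smul_eq_mul, Nat.mul_assoc]

/-- Length of the second curve. [folklore] -/
theorem length_ovY : (ovY I).length = κ₂ I.d + I.n * (ℓy₃ I.d + κ₂ I.d) := by
  unfold ovY; rw [length_ga]
  have : ((YsOV I).map fun X => X.length + κ₂ I.d) = (YsOV I).map fun _ => ℓy₃ I.d + κ₂ I.d := by
    refine List.map_congr_left fun X hX => ?_
    unfold YsOV at hX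
    simp only [List.mem_map, List.mem_finRange, true_and] at hX
    obtain ⟨j, rfl⟩ := hX
    rw [length_nvgY (length_bVec I j)]
  rw [this, List.map_const', List.sum_replicate, length_YsOV, smul_eq_mul]

/-- **Linear size of the DTW instance**: `|x| + |y| ≤ 2000 (n + 1)(d + 1)` and both curves are
nonempty. [folklore] -/
theorem length_ov_bounds : 1 ≤ (ovX I).length ∧ 1 ≤ (ovY I).length ∧
    (ovX I).length + (ovY I).length ≤ 2000 * (I.n + 1) * (I.d + 1) ∧ M₂ I.d ≤ (ovX I).length := by
  obtain ⟨hκ, -, hMκ, h1, h2, h3⟩ := params₃ I.d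
  rw [length_ovX, length_ovY, h1, h2, h3]
  rw [h3] at hMκ
  unfold dd at hMκ ⊢
  refine ⟨by omega, by omega, ?_, by nlinarith [Nat.zero_le (2 * I.n * (52 * (I.d + 1) + 3 + (344 * (I.d + 1) + 21)))]⟩
  nlinarith [Nat.zero_le I.n, Nat.zero_le I.d, Nat.zero_le (I.n * I.d)]

/-- All points of the two curves lie in `[0, M₂]`. [folklore] -/
theorem ov_vals : ∀ w ∈ ovX I ++ ovY I, 0 ≤ w ∧ w ≤ M₂ I.d := by
  obtain ⟨hκ, hM2, -⟩ := params₃ I.d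
  have hM1 : (0 : ℤ) ≤ M₁ I.d := by positivity
  intro w hw
  rcases List.mem_append.1 hw with hw | hw
  · unfold ovX at hw
    rcases (mem_ga_iff _ hκ _ w).1 hw with rfl | ⟨X, hX, hwX⟩
    · exact ⟨by rw [hM2]; linarith, le_rfl⟩
    · obtain ⟨i, rfl⟩ := mem_XsOV I hX
      have := nvgX_vals (length_aVec I i) w hwX
      exact ⟨this.1, by rw [hM2]; linarith⟩
  · unfold ovY at hw
    rcases (mem_ga_iff _ hκ _ w).1 hw with rfl | ⟨X, hX, hwX⟩
    · exact ⟨by rw [hM2]; linarith, le_rfl⟩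
    · unfold YsOV at hX
      simp only [List.mem_map, List.mem_finRange, true_and] at hX
      obtain ⟨j, rfl⟩ := hX
      have := nvgY_vals (length_bVec I j) w hwX
      exact ⟨this.1, by rw [hM2]; linarith⟩

/-- The entries are bounded by the total length (`c ≥ 1`), as required by `DTW c`. [folklore] -/
theorem hasBoundedEntries_ov {c : ℕ} (hc : 1 ≤ c) :
    HasBoundedEntries (ovX I ++ ovY I) (((ovX I).length + (ovY I).length) ^ c) := by
  obtain ⟨hx1, hy1, -, hM⟩ := length_ov_bounds I
  intro w hw
  obtain ⟨h0, hle⟩ := ov_vals I w hw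
  rw [abs_of_nonneg h0]
  refine hle.trans ?_
  have h1 : M₂ I.d ≤ (ovX I).length + (ovY I).length := by omega
  have h2 : (ovX I).length + (ovY I).length ≤ ((ovX I).length + (ovY I).length) ^ c := by
    calc (ovX I).length + (ovY I).length = ((ovX I).length + (ovY I).length) ^ 1 := (pow_one _).symm
      _ ≤ ((ovX I).length + (ovY I).length) ^ c := Nat.pow_le_pow_right (by omega) hc
  exact_mod_cast h1.trans h2

/-- **The DTW instance of an OV instance** (problem `DTW c` of the zoo, `c ≥ 1`): the pair of
curves `(ovX I, ovY I)` — nonempty, entries in `[0, M₂] ⊆ [-N^c, N^c]`.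
[cite: BringmannKunnemannFOCS2015, Thm. 1.1 (proof via Thm. 3.3)] -/
def ovDTWInst (c : ℕ) (hc : 1 ≤ c) (I : OVInstance) : (DTW c).Inst :=
  ⟨(ovX I, ovY I), ga_ne_nil _ (params₃ I.d).1 _, ga_ne_nil _ (params₃ I.d).1 _, hasBoundedEntries_ov I hc⟩

/-- The accepted output on the DTW instance is the distance of the two curves. [folklore] -/
theorem good_ovDTWInst {c : ℕ} (hc : 1 ≤ c) :
    (DTW c).Good (ovDTWInst c hc I) = {[(dtwDist (ovX I) (ovY I)).toNat]} := rfl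

/-- The word encoding of the DTW instance. [folklore] -/
theorem encode_ovDTWInst {c : ℕ} (hc : 1 ≤ c) :
    (DTW c).encode (ovDTWInst c hc I) = (ovX I).length :: encodeIntList (ovX I ++ ovY I) := rfl

/-- The size of the DTW instance is the total length. [folklore] -/
theorem size_ovDTWInst {c : ℕ} (hc : 1 ≤ c) :
    (DTW c).size (ovDTWInst c hc I) = (ovX I).length + (ovY I).length := rfl

/-- **Deciding OV from the DTW value**: an output accepted for the DTW instance is `[v]` with
`v ≤ thr I ↔ I.HasOrthogonalPair` (`n ≥ 1`). [cite: BringmannKunnemannFOCS2015, Thm. 3.3 (proof, §3.1)] -/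
theorem good_ovDTWInst_iff {c : ℕ} (hc : 1 ≤ c) (hn : 1 ≤ I.n) {out : List ℕ}
    (hout : out ∈ (DTW c).Good (ovDTWInst c hc I)) :
    ∃ v : ℕ, out = [v] ∧ (v ≤ thr I ↔ I.HasOrthogonalPair) := by
  rw [good_ovDTWInst, Set.mem_singleton_iff] at hout
  exact ⟨_, hout, toNat_dtwDist_ov_le_thr_iff I hn⟩

end packaging

end DTWRed

end Literature.Computability.FineGrained
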